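import Mathlib
import HarnessLib

/-!
# Route `PoloidalWindowDoor`, crux `PoloidalWindowRigidity` (stmt-19708), line `sparse_energy` (cstrat g11) —
# stub S1 `stub_scaledEnergy`, near-apex bootstrap: THE FIVE TIME INTEGRALS of the rounds

Seat ns-poloidal-K2-p2 g9 (successor of the interim LEAD-of-record on 19708; file `--supports`).  The three rounds of the near-apex
bootstrap (line card §Stubs S1; S1-NEAR-DESIGN-K2p2-g9 §2; CENSUS-19708-K2p2-g9 §5.0) integrate, over the window `(s, t₀) ⊂ (−∞, 0)`
(`s = −R²`), envelopes built from `(−t)⁻¹`, `(−t)^{−3/2}`, `(−t)^{−1/2}`, `log((−s)/(−t))` and `(−t)^{−1/2} log((−s)/(−t))`.  This file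
provides exactly these one-variable facts (FTC with explicit antiderivatives), for `s < t₀ < 0`:

* `integral_inv_neg` : `∫_s^{t₀} (−t)⁻¹ dt = log((−s)/(−t₀))` (the round-1 logarithm);
* `integral_neg_rpow_three_halves_le` : `∫_s^{t₀} (−t)^{−3/2} ≤ 2/√(−t₀)`;
* `integral_inv_sqrt_neg_le` : `∫_s^{t₀} 1/√(−t) ≤ 2√(−s)`;
* `integral_log_ratio_le` : `∫_s^{t₀} (log(−s) − log(−t)) dt ≤ −s`  (`∫₀¹ log(1/u) du = 1`);
* `integral_inv_sqrt_mul_log_ratio_le` : `∫_s^{t₀} log((−s)/(−t))/√(−t) dt ≤ 4√(−s)`  (`∫₀¹ u^{−1/2} log(1/u) du = 4`).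

WHAT THIS IS NOT: not a claim about Navier–Stokes — calculus (bears_on LADDER-NS N0 via crux 19708, line sparse_energy, stub S1). [folklore]
-/

noncomputable section

-- the summit and its single sub-problem share the name (CONVENTIONS §1), as in every Theorems file
set_option linter.dupNamespace false

namespace Summit.NavierStokesRegularity.NavierStokesRegularity.Theorems.PoloidalWindowDoorPoloidalWindowRigiditySparseEnergyTimeWeights

open MeasureTheory Set intervalIntegral

/-! ### Antiderivatives on `t < 0` -/

/-- `d/dt (−log(−t)) = (−t)⁻¹`. [folklore] -/
theorem hasDerivAt_neg_log_neg {t : ℝ} (ht : t < 0) : HasDerivAt (fun τ : ℝ => -Real.log (-τ)) ((-t)⁻¹) t := by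
  have h := ((Real.hasDerivAt_log (neg_ne_zero.2 ht.ne)).comp t (hasDerivAt_neg t)).neg
  refine h.congr_deriv ?_
  field_simp

/-- `d/dt (2/√(−t)) = (−t)^{−3/2} = 1/((−t)√(−t))`. [folklore] -/
theorem hasDerivAt_two_div_sqrt_neg {t : ℝ} (ht : t < 0) :
    HasDerivAt (fun τ : ℝ => 2 * (Real.sqrt (-τ))⁻¹) (1 / ((-t) * Real.sqrt (-t))) t := by
  have hnt : 0 < -t := neg_pos.2 ht
  have hsq : 0 < Real.sqrt (-t) := Real.sqrt_pos.2 hnt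
  have h1 : HasDerivAt (fun τ => Real.sqrt (-τ)) (1 / (2 * Real.sqrt (-t)) * (-1)) t :=
    (Real.hasDerivAt_sqrt hnt.ne').comp t (hasDerivAt_neg t)
  have h := (h1.inv hsq.ne').const_mul 2
  refine h.congr_deriv ?_
  have hs2 : Real.sqrt (-t) ^ 2 = -t := Real.sq_sqrt hnt.le
  rw [hs2]
  field_simp

/-- `d/dt (−2√(−t)) = 1/√(−t)`. [folklore] -/
theorem hasDerivAt_neg_two_sqrt_neg {t : ℝ} (ht : t < 0) :
    HasDerivAt (fun τ : ℝ => -2 * Real.sqrt (-τ)) (1 / Real.sqrt (-t)) t := by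
  have hnt : 0 < -t := neg_pos.2 ht
  have h1 : HasDerivAt (fun τ => Real.sqrt (-τ)) (1 / (2 * Real.sqrt (-t)) * (-1)) t :=
    (Real.hasDerivAt_sqrt hnt.ne').comp t (hasDerivAt_neg t)
  refine (h1.const_mul (-2)).congr_deriv ?_
  field_simp

/-- `d/dt [t − (−t)(log(−s) − log(−t))] = log(−s) − log(−t)` (`= log((−s)/(−t))`) on `t < 0`. [folklore] -/
theorem hasDerivAt_logRatio_prim (s : ℝ) {t : ℝ} (ht : t < 0) :
    HasDerivAt (fun τ : ℝ => τ - (-τ) * (Real.log (-s) - Real.log (-τ))) (Real.log (-s) - Real.log (-t)) t := by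
  have hl : HasDerivAt (fun τ : ℝ => Real.log (-τ)) ((-t)⁻¹ * (-1)) t :=
    (Real.hasDerivAt_log (neg_ne_zero.2 ht.ne)).comp t (hasDerivAt_neg t)
  have h := (hasDerivAt_id t).sub ((hasDerivAt_neg t).mul (hl.const_sub (Real.log (-s))))
  refine h.congr_deriv ?_
  have ht0 : t ≠ 0 := ht.ne
  field_simp
  ring

/-- `d/dt [−2√(−t)(log(−s) − log(−t)) − 4√(−t)] = (log(−s) − log(−t))/√(−t)` on `t < 0`. [folklore] -/
theorem hasDerivAt_sqrtLogRatio_prim (s : ℝ) {t : ℝ} (ht : t < 0) :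
    HasDerivAt (fun τ : ℝ => -2 * Real.sqrt (-τ) * (Real.log (-s) - Real.log (-τ)) - 4 * Real.sqrt (-τ))
      ((Real.log (-s) - Real.log (-t)) / Real.sqrt (-t)) t := by
  have hnt : 0 < -t := neg_pos.2 ht
  have hsq : 0 < Real.sqrt (-t) := Real.sqrt_pos.2 hnt
  have h1 : HasDerivAt (fun τ => Real.sqrt (-τ)) (1 / (2 * Real.sqrt (-t)) * (-1)) t :=
    (Real.hasDerivAt_sqrt hnt.ne').comp t (hasDerivAt_neg t)
  have hl : HasDerivAt (fun τ : ℝ => Real.log (-τ)) ((-t)⁻¹ * (-1)) t :=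
    (Real.hasDerivAt_log hnt.ne').comp t (hasDerivAt_neg t)
  have h := (((h1.const_mul (-2)).mul (hl.const_sub (Real.log (-s))))).sub (h1.const_mul 4)
  refine h.congr_deriv ?_
  have hs2 : Real.sqrt (-t) ^ 2 = -t := Real.sq_sqrt hnt.le
  have ht0 : t ≠ 0 := ht.ne
  field_simp
  rw [hs2]
  ring

/-! ### The five window integrals (`s < t₀ < 0`) -/

/-- **`∫_s^{t₀} (−t)⁻¹ dt = log((−s)/(−t₀))`** for `s < t₀ < 0`. [folklore] -/
theorem integral_inv_neg {s t₀ : ℝ} (hst : s < t₀) (ht₀ : t₀ < 0) :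
    ∫ t in s..t₀, (-t)⁻¹ = Real.log ((-s) / (-t₀)) := by
  have hs0 : s < 0 := hst.trans ht₀
  have hderiv : ∀ t ∈ uIcc s t₀, HasDerivAt (fun τ : ℝ => -Real.log (-τ)) ((-t)⁻¹) t := by
    intro t ht; rw [uIcc_of_le hst.le] at ht; exact hasDerivAt_neg_log_neg (lt_of_le_of_lt ht.2 ht₀)
  have hcont : ContinuousOn (fun t : ℝ => (-t)⁻¹) (uIcc s t₀) := by
    rw [uIcc_of_le hst.le]
    exact (continuousOn_id.neg).inv₀ fun t ht => (neg_pos.2 (lt_of_le_of_lt ht.2 ht₀)).ne'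
  rw [integral_eq_sub_of_hasDerivAt hderiv hcont.intervalIntegrable,
    Real.log_div (neg_ne_zero.2 hs0.ne) (neg_ne_zero.2 ht₀.ne)]
  ring

/-- **`∫_s^{t₀} dt/((−t)√(−t)) ≤ 2/√(−t₀)`** for `s < t₀ < 0`. [folklore] -/
theorem integral_neg_rpow_three_halves_le {s t₀ : ℝ} (hst : s < t₀) (ht₀ : t₀ < 0) :
    ∫ t in s..t₀, 1 / ((-t) * Real.sqrt (-t)) ≤ 2 / Real.sqrt (-t₀) := by
  have hs0 : s < 0 := hst.trans ht₀
  have hderiv : ∀ t ∈ uIcc s t₀, HasDerivAt (fun τ : ℝ => 2 * (Real.sqrt (-τ))⁻¹) (1 / ((-t) * Real.sqrt (-t))) t := by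
    intro t ht; rw [uIcc_of_le hst.le] at ht; exact hasDerivAt_two_div_sqrt_neg (lt_of_le_of_lt ht.2 ht₀)
  have hcont : ContinuousOn (fun t : ℝ => 1 / ((-t) * Real.sqrt (-t))) (uIcc s t₀) := by
    rw [uIcc_of_le hst.le]
    refine continuousOn_const.div ((continuousOn_id.neg).mul (continuousOn_id.neg.sqrt)) fun t ht => ?_
    have hnt : 0 < -t := neg_pos.2 (lt_of_le_of_lt ht.2 ht₀)
    exact (mul_pos hnt (Real.sqrt_pos.2 hnt)).ne'
  rw [integral_eq_sub_of_hasDerivAt hderiv hcont.intervalIntegrable]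
  have h1 : 0 ≤ 2 * (Real.sqrt (-s))⁻¹ := by positivity
  have e : 2 * (Real.sqrt (-t₀))⁻¹ = 2 / Real.sqrt (-t₀) := by rw [div_eq_mul_inv]
  linarith

/-- **`∫_s^{t₀} dt/√(−t) ≤ 2√(−s)`** for `s < t₀ < 0`. [folklore] -/
theorem integral_inv_sqrt_neg_le {s t₀ : ℝ} (hst : s < t₀) (ht₀ : t₀ < 0) :
    ∫ t in s..t₀, 1 / Real.sqrt (-t) ≤ 2 * Real.sqrt (-s) := by
  have hderiv : ∀ t ∈ uIcc s t₀, HasDerivAt (fun τ : ℝ => -2 * Real.sqrt (-τ)) (1 / Real.sqrt (-t)) t := by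
    intro t ht; rw [uIcc_of_le hst.le] at ht; exact hasDerivAt_neg_two_sqrt_neg (lt_of_le_of_lt ht.2 ht₀)
  have hcont : ContinuousOn (fun t : ℝ => 1 / Real.sqrt (-t)) (uIcc s t₀) := by
    rw [uIcc_of_le hst.le]
    refine continuousOn_const.div (continuousOn_id.neg.sqrt) fun t ht => ?_
    exact (Real.sqrt_pos.2 (neg_pos.2 (lt_of_le_of_lt ht.2 ht₀))).ne'
  rw [integral_eq_sub_of_hasDerivAt hderiv hcont.intervalIntegrable]
  have h1 : 0 ≤ Real.sqrt (-t₀) := Real.sqrt_nonneg _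
  linarith

/-- **`∫_s^{t₀} (log(−s) − log(−t)) dt ≤ −s`** (`= ∫ log((−s)/(−t))`; `∫₀¹ log(1/u) du = 1`) for `s < t₀ < 0`. [folklore] -/
theorem integral_log_ratio_le {s t₀ : ℝ} (hst : s < t₀) (ht₀ : t₀ < 0) :
    ∫ t in s..t₀, (Real.log (-s) - Real.log (-t)) ≤ -s := by
  have hs0 : s < 0 := hst.trans ht₀
  have hderiv : ∀ t ∈ uIcc s t₀, HasDerivAt (fun τ : ℝ => τ - (-τ) * (Real.log (-s) - Real.log (-τ)))
      (Real.log (-s) - Real.log (-t)) t := by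
    intro t ht; rw [uIcc_of_le hst.le] at ht; exact hasDerivAt_logRatio_prim s (lt_of_le_of_lt ht.2 ht₀)
  have hcont : ContinuousOn (fun t : ℝ => Real.log (-s) - Real.log (-t)) (uIcc s t₀) := by
    rw [uIcc_of_le hst.le]
    exact continuousOn_const.sub ((continuousOn_id.neg).log fun t ht => (neg_pos.2 (lt_of_le_of_lt ht.2 ht₀)).ne')
  rw [integral_eq_sub_of_hasDerivAt hderiv hcont.intervalIntegrable]
  simp only [sub_self, mul_zero, sub_zero]
  -- value: t₀ − (−t₀)(log(−s) − log(−t₀)) − s ≤ −s since both t₀ ≤ 0 and −(−t₀)·L ≤ 0 (L ≥ 0)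
  have hnt₀ : 0 < -t₀ := neg_pos.2 ht₀
  have hL : 0 ≤ Real.log (-s) - Real.log (-t₀) := by
    rw [sub_nonneg]; exact Real.log_le_log hnt₀ (by linarith)
  nlinarith [mul_nonneg hnt₀.le hL]

/-- **`∫_s^{t₀} (log(−s) − log(−t))/√(−t) dt ≤ 4√(−s)`** (`∫₀¹ u^{−1/2} log(1/u) du = 4`) for `s < t₀ < 0`. [folklore] -/
theorem integral_inv_sqrt_mul_log_ratio_le {s t₀ : ℝ} (hst : s < t₀) (ht₀ : t₀ < 0) :
    ∫ t in s..t₀, (Real.log (-s) - Real.log (-t)) / Real.sqrt (-t) ≤ 4 * Real.sqrt (-s) := by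
  have hs0 : s < 0 := hst.trans ht₀
  have hderiv : ∀ t ∈ uIcc s t₀, HasDerivAt (fun τ : ℝ => -2 * Real.sqrt (-τ) * (Real.log (-s) - Real.log (-τ)) - 4 * Real.sqrt (-τ))
      ((Real.log (-s) - Real.log (-t)) / Real.sqrt (-t)) t := by
    intro t ht; rw [uIcc_of_le hst.le] at ht; exact hasDerivAt_sqrtLogRatio_prim s (lt_of_le_of_lt ht.2 ht₀)
  have hcont : ContinuousOn (fun t : ℝ => (Real.log (-s) - Real.log (-t)) / Real.sqrt (-t)) (uIcc s t₀) := by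
    rw [uIcc_of_le hst.le]
    refine (continuousOn_const.sub ((continuousOn_id.neg).log fun t ht => ?_)).div (continuousOn_id.neg.sqrt) fun t ht => ?_
    · exact (neg_pos.2 (lt_of_le_of_lt ht.2 ht₀)).ne'
    · exact (Real.sqrt_pos.2 (neg_pos.2 (lt_of_le_of_lt ht.2 ht₀))).ne'
  rw [integral_eq_sub_of_hasDerivAt hderiv hcont.intervalIntegrable]
  simp only [sub_self, mul_zero, zero_sub]
  -- value: [−2√(−t₀) L(t₀) − 4√(−t₀)] + 4√(−s) with L(t₀) ≥ 0
  have hnt₀ : 0 < -t₀ := neg_pos.2 ht₀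
  have hL : 0 ≤ Real.log (-s) - Real.log (-t₀) := by
    rw [sub_nonneg]; exact Real.log_le_log hnt₀ (by linarith)
  have h1 : 0 ≤ Real.sqrt (-t₀) := Real.sqrt_nonneg _
  nlinarith [mul_nonneg h1 hL]

end Summit.NavierStokesRegularity.NavierStokesRegularity.Theorems.PoloidalWindowDoorPoloidalWindowRigiditySparseEnergyTimeWeights

end
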